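import Literature.Computability.Complexity.KarpChromaticGraph
import Literature.Computability.Complexity.ChromaticNP
import Literature.Computability.Complexity.OneInThreeSATMachine
import HarnessLib

/-!
# `3SAT ≤ₚ CHROMATIC NUMBER`, the machine half, and the discharge of `isNPComplete_CHROMATIC`

Karp 1972, Main Theorem, problem 12: CHROMATIC NUMBER is NP-complete, by membership in `NP` and the
reduction "SATISFIABILITY WITH AT MOST 3 LITERALS PER CLAUSE ∝ CHROMATIC NUMBER".
`KarpChromaticGraph.lean` proves Karp's equivalence for the graph `KarpChromatic.graph L` of a family
of slot literals (`colorable_iff_satisfiable`); `ChromaticNP.lean` proves `CHROMATIC ∈ NP`. This file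
computes the CODE of that graph from a CNF code in polynomial time and assembles:

* the `FP` map `KarpChromatic.karpFn : w ↦ ⟨⟨⌜12 r⌝, adjacency bits⟩, ⌜3 r + 1⌝⟩` (`r` clauses), whose
  adjacency bits are, on EVERY string `w`, the code (`encodingGraphFin`) of Karp's graph of the slot
  literals READ OFF `w` (`adjBlocksF_eq_encode`), transported to `Fin (4 · (r · 3))` along the
  block numbering `vertexEquiv` (kind-major, then clause, then slot);
* the guarded map `toChromFn` (canonical code of a CNF of width `≤ 3` without empty clauses ?
  `karpFn w` : the non-code `[1]`), `toChromFn_mem_FP`;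
* **`kSAT_three_karpReducible_CHROMATIC : kSAT 3 ≤ₚ CHROMATIC`** and
  **`isNPComplete_CHROMATIC_holds`** (`KarpProblems.lean`, pnp.S10 problem 12) from the tree's
  `isNPComplete_kSAT_three_holds` (Arora–Barak Thm. 2.10 (2)), `IsComplete.of_reducible_holds` and
  `ChromaticNP.CHROMATIC_mem_NP`.

## The machine (brick algebra; no machine is written)

The adjacency matrix is emitted kind-block by kind-block. A row of the matrix belongs to a vertex
`(κ, i, j)`; the rows of kind `κ` are produced by a counted fold (`Brick.foldLoop appF`) over the
clause index `i` (unary `1ⁱ`) whose piece on `a = ⟨w, 1ⁱ⟩` is the GROUP of the three rows `j = 0, 1, 2`;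
a row is the concatenation over the column kinds `κ'` of an inner fold over the column clause index
`i'` whose piece on `q = ⟨a, 1^{i'}⟩` is the three bits `j' = 0, 1, 2`. Every bit is a one-bit brick in
`q`: equality of the unary indices (`eqPairFn`), equality of the VALUES of the variable numerals of
two slots (`Brick.eqValFn` on the raw slot items `OneInThree.slotF`), and the polarity bit of a slot
(`OneInThree.polF`). All positions `j, j'` and kinds are Lean-level constants, so no index is ever
divided.

## References

* [Karp1972] R. M. Karp, *Reducibility among combinatorial problems* (1972), §4, proof of the Main
  Theorem, `SATISFIABILITY WITH AT MOST 3 LITERALS PER CLAUSE ∝ CHROMATIC NUMBER`; Main Theorem,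
  problem 12.
* [AroraBarakCC2009] S. Arora, B. Barak, *Computational Complexity*, CUP 2009, §1.3 (polynomial
  time is closed under composition and bounded loops), §0.1 (adjacency matrices), Thm. 2.8,
  Thm. 2.10 (2).
-/

noncomputable section

namespace Literature.Computability.Complexity

namespace KarpChromatic

open _root_.Computability Polynomial Brick HashBricks NegCNF Ladder3 Plumb OneInThree
open scoped Notation

/-! ### The bit bricks on `q = ⟨⟨w, 1ⁱ⟩, 1^{i'}⟩` -/

/-- On `q`: the code `w`. [folklore] -/
def wQ : List Bool → List Bool := fstF ∘ fstF
/-- On `q`: the row clause index `1ⁱ`. [folklore] -/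
def rowU : List Bool → List Bool := sndF ∘ fstF
/-- On `q`: the column clause index `1^{i'}`. [folklore] -/
def colU : List Bool → List Bool := sndF
/-- On `q`: the argument `⟨w, 1^{i'}⟩` of the column slot bricks. [folklore] -/
def colArg : List Bool → List Bool := fanoutFn wQ colU

/-- The bit `[i = i']` (string equality of the unary indices). [folklore] -/
def eqClauseF : List Bool → List Bool := eqPairFn ∘ fanoutFn rowU colU
/-- The bit `[(i, j) ≠ (i', j')]` for fixed positions `j, j'`. [folklore] -/
def neSlotF (j j' : ℕ) : List Bool → List Bool := notFn (andFn eqClauseF fun _ => [decide (j = j')])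
/-- The bit `[⟦var (i, j)⟧ = ⟦var (i', j')⟧]` (values of the variable numerals of the two raw slot
items). [folklore] -/
def sameVarF (j j' : ℕ) : List Bool → List Bool :=
  eqValFn ∘ fanoutFn (fstF ∘ slotF j ∘ fstF) (fstF ∘ slotF j' ∘ colArg)
/-- The polarity bit of the row slot `(i, j)`. [folklore] -/
def rowPolF (j : ℕ) : List Bool → List Bool := polF j ∘ fstF
/-- The polarity bit of the column slot `(i', j')`. [folklore] -/
def colPolF (j' : ℕ) : List Bool → List Bool := polF j' ∘ colArg

/-- **The adjacency bit** of row vertex `(κ, i, j)` and column vertex `(κ', i', j')`, as a brick on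
`q` (the arcs of `KarpChromatic.Adj`). [cite: Karp1972, §4 Main Theorem (proof), SAT≤3 ∝ CHROMATIC
NUMBER] -/
def bitF : Kind → ℕ → Kind → ℕ → (List Bool → List Bool)
  | Kind.v, j, Kind.v, j' => neSlotF j j'
  | Kind.v, j, Kind.pos, j' => neSlotF j j'
  | Kind.v, j, Kind.neg, j' => neSlotF j j'
  | Kind.pos, j, Kind.v, j' => neSlotF j j'
  | Kind.neg, j, Kind.v, j' => neSlotF j j'
  | Kind.pos, j, Kind.neg, j' => sameVarF j j'
  | Kind.neg, j, Kind.pos, j' => sameVarF j j'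
  | Kind.pos, j, Kind.cl, _ => notFn (andFn eqClauseF (rowPolF j))
  | Kind.cl, _, Kind.pos, j' => notFn (andFn eqClauseF (colPolF j'))
  | Kind.neg, j, Kind.cl, _ => notFn (andFn eqClauseF (notFn (rowPolF j)))
  | Kind.cl, _, Kind.neg, j' => notFn (andFn eqClauseF (notFn (colPolF j')))
  | _, _, _, _ => fun _ => [false]

/-- The three bits of the column slots `(i', 0), (i', 1), (i', 2)` of kind `κ'`. [folklore] -/
def tripleF (κ : Kind) (j : ℕ) (κ' : Kind) : List Bool → List Bool :=
  fun q => bitF κ j κ' 0 q ++ bitF κ j κ' 1 q ++ bitF κ j κ' 2 q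

/-! ### Rows, groups, blocks -/

/-- The initial record `⟨a, ⟨⌜r⌝, ⟨1⁰, ε⟩⟩⟩` of the inner fold on `a = ⟨w, 1ⁱ⟩` (`r = |fstF w|`). [folklore] -/
def colFoldInit : List Bool → List Bool := fanoutFn id (fanoutFn (lenBinF ∘ fstF ∘ fstF) fun _ => boolPair [] [])
/-- **The inner fold**: the `3r` bits of the columns of kind `κ'`, by `Brick.foldLoop appF (clipF 3 _) X`.
[cite: AroraBarakCC2009, §1.3 (bounded loops)] -/
def innerF (κ : Kind) (j : ℕ) (κ' : Kind) : List Bool → List Bool :=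
  sndPow 2 ∘ foldLoop appF (clipF 3 (tripleF κ j κ')) X ∘ colFoldInit
/-- **A row**: the four column blocks. [folklore] -/
def rowF (κ : Kind) (j : ℕ) : List Bool → List Bool :=
  fun a => innerF κ j Kind.v a ++ innerF κ j Kind.pos a ++ innerF κ j Kind.neg a ++ innerF κ j Kind.cl a
/-- **A group**: the three rows `j = 0, 1, 2` of clause `i`. [folklore] -/
def groupF (κ : Kind) : List Bool → List Bool := fun a => rowF κ 0 a ++ rowF κ 1 a ++ rowF κ 2 a
/-- The initial record `⟨w, ⟨⌜r⌝, ⟨1⁰, ε⟩⟩⟩` of the outer folds. [folklore] -/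
def blockFoldInit : List Bool → List Bool := fanoutFn id (fanoutFn (lenBinF ∘ fstF) fun _ => boolPair [] [])
/-- The clip constant of the outer folds (`36 r ≤ 36 (|w| + 1)` bits per group). [folklore] -/
def Cblk : ℕ := 36
/-- **A block**: the rows of kind `κ`, by `Brick.foldLoop appF (clipF Cblk (groupF κ)) X`.
[cite: AroraBarakCC2009, §1.3 (bounded loops)] -/
def blockF (κ : Kind) : List Bool → List Bool := sndPow 2 ∘ foldLoop appF (clipF Cblk (groupF κ)) X ∘ blockFoldInit
/-- **The adjacency bits**: the four blocks. [cite: Karp1972, §4 Main Theorem (proof), SAT≤3 ∝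
CHROMATIC NUMBER] -/
def adjBlocksF : List Bool → List Bool := fun w => blockF Kind.v w ++ blockF Kind.pos w ++ blockF Kind.neg w ++ blockF Kind.cl w

/-! ### Numerals, the map, the guard -/

/-- `⌜3 r⌝`. [folklore] -/
def threeRF : List Bool → List Bool := prodFn ∘ fanoutFn (lenBinF ∘ fstF) fun _ => encodeNat 3
/-- `⌜4 (3 r)⌝`, the number of vertices. [folklore] -/
def vertexNumF : List Bool → List Bool := prodFn ∘ fanoutFn (fun _ => encodeNat 4) threeRF
/-- `⌜3 r + 1⌝`, the number of colours. [folklore] -/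
def colourNumF : List Bool → List Bool := addFn ∘ fanoutFn threeRF fun _ => encodeNat 1
/-- **Karp's map on codes**: `w ↦ ⟨⟨⌜12 r⌝, adjacency bits⟩, ⌜3 r + 1⌝⟩`. [cite: Karp1972, §4 Main
Theorem (proof), SAT≤3 ∝ CHROMATIC NUMBER] -/
def karpFn : List Bool → List Bool := fanoutFn (fanoutFn vertexNumF adjBlocksF) colourNumF
/-- The one-bit test "no clause code announces zero literals" (`Brick.allFn` over the clause codes).
[cite: AroraBarakCC2009, §1.3 (bounded loops)] -/
def nonemptyFn : List Bool → List Bool :=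
  allFn (notFn (KSATRed.widthItemFn 0)) ∘ fanoutFn (fun _ => []) sndF
/-- The guard: canonical code, width `≤ 3`, no empty clause. [folklore] -/
def guard3F : List Bool → List Bool := andFn (andFn KSATRed.isCanonFn (KSATRed.widthLEFn 3)) nonemptyFn
/-- **The reduction `3SAT → CHROMATIC NUMBER` on strings**: Karp's map on guarded codes, the non-code
`[1]` otherwise. [cite: Karp1972, §4 Main Theorem (proof), SAT≤3 ∝ CHROMATIC NUMBER] -/
def toChromFn : List Bool → List Bool := iteFn guard3F karpFn fun _ => [true]

/-! ### Membership in `FP` -/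

/-- `colArg ∈ FP`. [cite: AroraBarakCC2009, §1.3] -/
theorem colArg_mem_FP : colArg ∈ FP :=
  fanoutFn_mem_FP (comp_mem_FP fstF_mem_FP fstF_mem_FP) sndF_mem_FP
/-- `eqClauseF ∈ FP`. [cite: AroraBarakCC2009, §1.3] -/
theorem eqClauseF_mem_FP : eqClauseF ∈ FP :=
  comp_mem_FP eqPairFn_mem_FP (fanoutFn_mem_FP (comp_mem_FP sndF_mem_FP fstF_mem_FP) sndF_mem_FP)
/-- `neSlotF j j' ∈ FP`. [cite: AroraBarakCC2009, §1.3] -/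
theorem neSlotF_mem_FP (j j' : ℕ) : neSlotF j j' ∈ FP := notFn_mem_FP (andFn_mem_FP eqClauseF_mem_FP (const_mem_FP _))
/-- `sameVarF j j' ∈ FP`. [cite: AroraBarakCC2009, §1.3] -/
theorem sameVarF_mem_FP (j j' : ℕ) : sameVarF j j' ∈ FP :=
  comp_mem_FP eqValFn_mem_FP (fanoutFn_mem_FP (comp_mem_FP fstF_mem_FP (comp_mem_FP (slotF_mem_FP j) fstF_mem_FP))
    (comp_mem_FP fstF_mem_FP (comp_mem_FP (slotF_mem_FP j') colArg_mem_FP)))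
/-- `rowPolF j ∈ FP`. [cite: AroraBarakCC2009, §1.3] -/
theorem rowPolF_mem_FP (j : ℕ) : rowPolF j ∈ FP := comp_mem_FP (polF_mem_FP j) fstF_mem_FP
/-- `colPolF j' ∈ FP`. [cite: AroraBarakCC2009, §1.3] -/
theorem colPolF_mem_FP (j' : ℕ) : colPolF j' ∈ FP := comp_mem_FP (polF_mem_FP j') colArg_mem_FP

/-- **Every adjacency bit is in `FP`.** [cite: AroraBarakCC2009, §1.3] -/
theorem bitF_mem_FP : ∀ (κ : Kind) (j : ℕ) (κ' : Kind) (j' : ℕ), bitF κ j κ' j' ∈ FP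
  | Kind.v, _, Kind.v, _ => neSlotF_mem_FP _ _
  | Kind.v, _, Kind.pos, _ => neSlotF_mem_FP _ _
  | Kind.v, _, Kind.neg, _ => neSlotF_mem_FP _ _
  | Kind.v, _, Kind.cl, _ => const_mem_FP _
  | Kind.pos, _, Kind.v, _ => neSlotF_mem_FP _ _
  | Kind.pos, _, Kind.pos, _ => const_mem_FP _
  | Kind.pos, _, Kind.neg, _ => sameVarF_mem_FP _ _
  | Kind.pos, _, Kind.cl, _ => notFn_mem_FP (andFn_mem_FP eqClauseF_mem_FP (rowPolF_mem_FP _))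
  | Kind.neg, _, Kind.v, _ => neSlotF_mem_FP _ _
  | Kind.neg, _, Kind.pos, _ => sameVarF_mem_FP _ _
  | Kind.neg, _, Kind.neg, _ => const_mem_FP _
  | Kind.neg, _, Kind.cl, _ => notFn_mem_FP (andFn_mem_FP eqClauseF_mem_FP (notFn_mem_FP (rowPolF_mem_FP _)))
  | Kind.cl, _, Kind.v, _ => const_mem_FP _
  | Kind.cl, _, Kind.pos, _ => notFn_mem_FP (andFn_mem_FP eqClauseF_mem_FP (colPolF_mem_FP _))
  | Kind.cl, _, Kind.neg, _ => notFn_mem_FP (andFn_mem_FP eqClauseF_mem_FP (notFn_mem_FP (colPolF_mem_FP _)))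
  | Kind.cl, _, Kind.cl, _ => const_mem_FP _

/-- `tripleF κ j κ' ∈ FP`. [cite: AroraBarakCC2009, §1.3] -/
theorem tripleF_mem_FP (κ : Kind) (j : ℕ) (κ' : Kind) : tripleF κ j κ' ∈ FP :=
  append_mem_FP (append_mem_FP (bitF_mem_FP κ j κ' 0) (bitF_mem_FP κ j κ' 1)) (bitF_mem_FP κ j κ' 2)
/-- `colFoldInit ∈ FP`. [cite: AroraBarakCC2009, §1.3] -/
theorem colFoldInit_mem_FP : colFoldInit ∈ FP :=
  fanoutFn_mem_FP OracleCompose.id_mem_FP (fanoutFn_mem_FP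
    (comp_mem_FP lenBinF_mem_FP (comp_mem_FP fstF_mem_FP fstF_mem_FP)) (const_mem_FP _))
/-- **`innerF κ j κ' ∈ FP`** (`foldLoop_clipF_mem_FP`). [cite: AroraBarakCC2009, §1.3 (bounded loops)] -/
theorem innerF_mem_FP (κ : Kind) (j : ℕ) (κ' : Kind) : innerF κ j κ' ∈ FP :=
  comp_mem_FP (sndPow_mem_FP 2) (comp_mem_FP
    (foldLoop_clipF_mem_FP 3 appF_mem_FP length_appF_le (tripleF_mem_FP κ j κ') _) colFoldInit_mem_FP)
/-- `rowF κ j ∈ FP`. [cite: AroraBarakCC2009, §1.3] -/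
theorem rowF_mem_FP (κ : Kind) (j : ℕ) : rowF κ j ∈ FP :=
  append_mem_FP (append_mem_FP (append_mem_FP (innerF_mem_FP κ j _) (innerF_mem_FP κ j _))
    (innerF_mem_FP κ j _)) (innerF_mem_FP κ j _)
/-- `groupF κ ∈ FP`. [cite: AroraBarakCC2009, §1.3] -/
theorem groupF_mem_FP (κ : Kind) : groupF κ ∈ FP :=
  append_mem_FP (append_mem_FP (rowF_mem_FP κ 0) (rowF_mem_FP κ 1)) (rowF_mem_FP κ 2)
/-- `blockFoldInit ∈ FP`. [cite: AroraBarakCC2009, §1.3] -/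
theorem blockFoldInit_mem_FP : blockFoldInit ∈ FP :=
  fanoutFn_mem_FP OracleCompose.id_mem_FP (fanoutFn_mem_FP (comp_mem_FP lenBinF_mem_FP fstF_mem_FP) (const_mem_FP _))
/-- **`blockF κ ∈ FP`** (`foldLoop_clipF_mem_FP`). [cite: AroraBarakCC2009, §1.3 (bounded loops)] -/
theorem blockF_mem_FP (κ : Kind) : blockF κ ∈ FP :=
  comp_mem_FP (sndPow_mem_FP 2) (comp_mem_FP
    (foldLoop_clipF_mem_FP Cblk appF_mem_FP length_appF_le (groupF_mem_FP κ) _) blockFoldInit_mem_FP)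
/-- **`adjBlocksF ∈ FP`.** [cite: AroraBarakCC2009, §1.3] -/
theorem adjBlocksF_mem_FP : adjBlocksF ∈ FP :=
  append_mem_FP (append_mem_FP (append_mem_FP (blockF_mem_FP _) (blockF_mem_FP _)) (blockF_mem_FP _)) (blockF_mem_FP _)
/-- `threeRF ∈ FP`. [cite: AroraBarakCC2009, §1.3] -/
theorem threeRF_mem_FP : threeRF ∈ FP :=
  comp_mem_FP prodFn_mem_FP (fanoutFn_mem_FP (comp_mem_FP lenBinF_mem_FP fstF_mem_FP) (const_mem_FP _))
/-- `vertexNumF ∈ FP`. [cite: AroraBarakCC2009, §1.3] -/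
theorem vertexNumF_mem_FP : vertexNumF ∈ FP := comp_mem_FP prodFn_mem_FP (fanoutFn_mem_FP (const_mem_FP _) threeRF_mem_FP)
/-- `colourNumF ∈ FP`. [cite: AroraBarakCC2009, §1.3] -/
theorem colourNumF_mem_FP : colourNumF ∈ FP := comp_mem_FP addFn_mem_FP (fanoutFn_mem_FP threeRF_mem_FP (const_mem_FP _))
/-- **`karpFn ∈ FP`.** [cite: AroraBarakCC2009, Thm. 2.8] -/
theorem karpFn_mem_FP : karpFn ∈ FP := fanoutFn_mem_FP (fanoutFn_mem_FP vertexNumF_mem_FP adjBlocksF_mem_FP) colourNumF_mem_FP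
/-- The clause-nonemptiness item test is one-bit. [folklore] -/
theorem oneBit_neItem : OneBit (notFn (KSATRed.widthItemFn 0)) := oneBit_notFn (KSATRed.oneBit_widthItemFn 0)
/-- `nonemptyFn ∈ FP`. [cite: AroraBarakCC2009, §1.3] -/
theorem nonemptyFn_mem_FP : nonemptyFn ∈ FP :=
  comp_mem_FP (allFn_mem_FP (notFn_mem_FP (KSATRed.widthItemFn_mem_FP 0)) oneBit_neItem)
    (fanoutFn_mem_FP (const_mem_FP _) sndF_mem_FP)
/-- `guard3F ∈ FP`. [cite: AroraBarakCC2009, §1.3] -/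
theorem guard3F_mem_FP : guard3F ∈ FP :=
  andFn_mem_FP (andFn_mem_FP KSATRed.isCanonFn_mem_FP (KSATRed.widthLEFn_mem_FP 3)) nonemptyFn_mem_FP
/-- **`toChromFn ∈ FP`.** [cite: AroraBarakCC2009, Thm. 2.8] -/
theorem toChromFn_mem_FP : toChromFn ∈ FP := iteFn_mem_FP guard3F_mem_FP karpFn_mem_FP (const_mem_FP _)

/-! ### Values of the bits on a genuine argument `q = ⟨⟨w, 1ⁱ⟩, 1^{i'}⟩` -/

/-- The slot literals READ OFF an arbitrary string `w` with `r = |fstF w|` announced clauses: slot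
`(i, j)` carries `(⟦variable numeral⟧, polarity bit)` of the raw slot item `OneInThree.sOf w i j`.
[folklore] -/
def litOf (w : List Bool) (i j : ℕ) : Literal ℕ := (bitsToNat (fstF (sOf w i j)), decodeBool (sndF (sOf w i j)))

/-- The genuine bit argument. [folklore] -/
def qArg (w : List Bool) (i i' : ℕ) : List Bool := boolPair (boolPair w (ones i)) (ones i')

/-- `colArg q = ⟨w, 1^{i'}⟩`. [folklore] -/
@[simp] theorem colArg_qArg (w : List Bool) (i i' : ℕ) : colArg (qArg w i i') = boolPair w (ones i') := by
  simp [colArg, wQ, colU, qArg]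

/-- `fstF q = ⟨w, 1ⁱ⟩`. [folklore] -/
@[simp] theorem fstF_qArg (w : List Bool) (i i' : ℕ) : fstF (qArg w i i') = boolPair w (ones i) := by
  simp [qArg]

/-- `eqClauseF q = [i = i']`. [folklore] -/
theorem eqClauseF_qArg (w : List Bool) (i i' : ℕ) : eqClauseF (qArg w i i') = [decide (i = i')] := by
  simp only [eqClauseF, rowU, colU, qArg, Function.comp_apply, fanoutFn_apply, fstF_boolPair, sndF_boolPair,
    eqPairFn_boolPair, List.replicate_left_inj]

/-- `neSlotF j j' q = [(i, j) ≠ (i', j')]`. [folklore] -/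
theorem neSlotF_qArg (j j' : ℕ) (w : List Bool) (i i' : ℕ) :
    neSlotF j j' (qArg w i i') = [!(decide (i = i') && decide (j = j'))] := by
  rw [neSlotF, notFn_apply (andFn_apply (eqClauseF_qArg w i i') rfl)]

/-- `sameVarF j j' q = [⟦var (i, j)⟧ = ⟦var (i', j')⟧]`. [folklore] -/
theorem sameVarF_qArg (j j' : ℕ) (w : List Bool) (i i' : ℕ) :
    sameVarF j j' (qArg w i i') = [decide ((litOf w i j).1 = (litOf w i' j').1)] := by
  simp only [sameVarF, Function.comp_apply, fanoutFn_apply, fstF_qArg, colArg_qArg, slotF_boolPair, eqValFn_boolPair]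
  rfl

/-- `rowPolF j q = [polarity of (i, j)]`. [folklore] -/
theorem rowPolF_qArg (j : ℕ) (w : List Bool) (i i' : ℕ) : rowPolF j (qArg w i i') = [(litOf w i j).2] := by
  rw [rowPolF, Function.comp_apply, fstF_qArg, polF_boolPair]; rfl

/-- `colPolF j' q = [polarity of (i', j')]`. [folklore] -/
theorem colPolF_qArg (j' : ℕ) (w : List Bool) (i i' : ℕ) : colPolF j' (qArg w i i') = [(litOf w i' j').2] := by
  rw [colPolF, Function.comp_apply, colArg_qArg, polF_boolPair]; rfl

/-- **The Boolean value of the adjacency bit** of `(κ, i, j)` and `(κ', i', j')` read off `w` (the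
table of `KarpChromatic.Adj` on the slot literals `litOf w`). [cite: Karp1972, §4 Main Theorem
(proof), SAT≤3 ∝ CHROMATIC NUMBER] -/
def bitVal (w : List Bool) : Kind → ℕ → Kind → ℕ → ℕ → ℕ → Bool
  | Kind.v, j, Kind.v, j', i, i' => !(decide (i = i') && decide (j = j'))
  | Kind.v, j, Kind.pos, j', i, i' => !(decide (i = i') && decide (j = j'))
  | Kind.v, j, Kind.neg, j', i, i' => !(decide (i = i') && decide (j = j'))
  | Kind.pos, j, Kind.v, j', i, i' => !(decide (i = i') && decide (j = j'))
  | Kind.neg, j, Kind.v, j', i, i' => !(decide (i = i') && decide (j = j'))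
  | Kind.pos, j, Kind.neg, j', i, i' => decide ((litOf w i j).1 = (litOf w i' j').1)
  | Kind.neg, j, Kind.pos, j', i, i' => decide ((litOf w i j).1 = (litOf w i' j').1)
  | Kind.pos, j, Kind.cl, _, i, i' => !(decide (i = i') && (litOf w i j).2)
  | Kind.cl, _, Kind.pos, j', i, i' => !(decide (i = i') && (litOf w i' j').2)
  | Kind.neg, j, Kind.cl, _, i, i' => !(decide (i = i') && !(litOf w i j).2)
  | Kind.cl, _, Kind.neg, j', i, i' => !(decide (i = i') && !(litOf w i' j').2)
  | _, _, _, _, _, _ => false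

/-- **Value of the adjacency bit brick** on a genuine argument. [folklore] -/
theorem bitF_qArg (κ : Kind) (j : ℕ) (κ' : Kind) (j' : ℕ) (w : List Bool) (i i' : ℕ) :
    bitF κ j κ' j' (qArg w i i') = [bitVal w κ j κ' j' i i'] := by
  cases κ <;> cases κ' <;> simp only [bitF, bitVal, neSlotF_qArg, sameVarF_qArg]
  · rw [notFn_apply (andFn_apply (eqClauseF_qArg w i i') (rowPolF_qArg j w i i'))]
  · rw [notFn_apply (andFn_apply (eqClauseF_qArg w i i') (notFn_apply (rowPolF_qArg j w i i')))]
  · rw [notFn_apply (andFn_apply (eqClauseF_qArg w i i') (colPolF_qArg j' w i i'))]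
  · rw [notFn_apply (andFn_apply (eqClauseF_qArg w i i') (notFn_apply (colPolF_qArg j' w i i')))]

/-- **Value of the triple** on a genuine argument: three bits. [folklore] -/
theorem tripleF_qArg (κ : Kind) (j : ℕ) (κ' : Kind) (w : List Bool) (i i' : ℕ) :
    tripleF κ j κ' (qArg w i i') = [bitVal w κ j κ' 0 i i', bitVal w κ j κ' 1 i i', bitVal w κ j κ' 2 i i'] := by
  simp [tripleF, bitF_qArg]

/-! ### Values of the folds -/

/-- The number of announced clauses of `w`. [folklore] -/
def rOf (w : List Bool) : ℕ := (fstF w).length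

/-- `r ≤ |w|`. [folklore] -/
theorem rOf_le (w : List Bool) : rOf w ≤ w.length := by
  have := length_fstF_sndF_le w; unfold rOf; omega

/-- The `3r` bits of the columns of kind `κ'` in row `(κ, i, j)`. [folklore] -/
def colBits (w : List Bool) (κ : Kind) (j : ℕ) (κ' : Kind) (i : ℕ) : List Bool :=
  ccat (fun i' => [bitVal w κ j κ' 0 i i', bitVal w κ j κ' 1 i i', bitVal w κ j κ' 2 i i']) (rOf w)
/-- The row of vertex `(κ, i, j)`. [folklore] -/
def rowBits (w : List Bool) (κ : Kind) (j i : ℕ) : List Bool :=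
  colBits w κ j Kind.v i ++ colBits w κ j Kind.pos i ++ colBits w κ j Kind.neg i ++ colBits w κ j Kind.cl i
/-- The three rows of clause `i` in block `κ`. [folklore] -/
def groupBits (w : List Bool) (κ : Kind) (i : ℕ) : List Bool :=
  rowBits w κ 0 i ++ rowBits w κ 1 i ++ rowBits w κ 2 i
/-- The block of kind `κ`. [folklore] -/
def blockBits (w : List Bool) (κ : Kind) : List Bool := ccat (groupBits w κ) (rOf w)
/-- **The adjacency bits read off `w`** (the value of `adjBlocksF`, `adjBlocksF_apply`). [folklore] -/
def adjBits (w : List Bool) : List Bool :=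
  blockBits w Kind.v ++ blockBits w Kind.pos ++ blockBits w Kind.neg ++ blockBits w Kind.cl

/-- Length of a concatenation of pieces of equal length. [folklore] -/
theorem length_ccat_const {g : ℕ → List Bool} {b : ℕ} (h : ∀ i, (g i).length = b) : ∀ n, (ccat g n).length = n * b
  | 0 => by simp
  | n + 1 => by rw [ccat_succ, List.length_append, length_ccat_const h n, h, Nat.succ_mul]

/-- `|colBits| = 3r`. [folklore] -/
theorem length_colBits (w : List Bool) (κ : Kind) (j : ℕ) (κ' : Kind) (i : ℕ) : (colBits w κ j κ' i).length = rOf w * 3 := by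
  unfold colBits
  exact length_ccat_const (b := 3) (fun _ => rfl) _
/-- `|rowBits| = 12r`. [folklore] -/
theorem length_rowBits (w : List Bool) (κ : Kind) (j i : ℕ) : (rowBits w κ j i).length = 4 * (rOf w * 3) := by
  simp only [rowBits, List.length_append, length_colBits]; ring
/-- `|groupBits| = 36r`. [folklore] -/
theorem length_groupBits (w : List Bool) (κ : Kind) (i : ℕ) : (groupBits w κ i).length = 3 * (4 * (rOf w * 3)) := by
  simp only [groupBits, List.length_append, length_rowBits]; ring
/-- `|blockBits| = r · 36r`. [folklore] -/
theorem length_blockBits (w : List Bool) (κ : Kind) : (blockBits w κ).length = rOf w * (3 * (4 * (rOf w * 3))) :=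
  length_ccat_const (length_groupBits w κ) _
/-- `|adjBits| = (12 r)²`. [folklore] -/
theorem length_adjBits (w : List Bool) : (adjBits w).length = (4 * (rOf w * 3)) * (4 * (rOf w * 3)) := by
  simp only [adjBits, List.length_append, length_blockBits]; ring

/-- **Value of the inner fold** on a genuine argument `a = ⟨w, 1ⁱ⟩`. [folklore] -/
theorem innerF_boolPair (κ : Kind) (j : ℕ) (κ' : Kind) (w : List Bool) (i : ℕ) :
    innerF κ j κ' (boolPair w (ones i)) = colBits w κ j κ' i := by
  have hinit : colFoldInit (boolPair w (ones i)) =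
      boolPair (boolPair w (ones i)) (boolPair (encodeNat (rOf w)) (boolPair (ones 0) [])) := by
    simp [colFoldInit, fanoutFn_apply, rOf]
  have hk : rOf w ≤ X.eval (boolPair w (ones i)).length := by
    rw [eval_X, length_boolPair]; have := rOf_le w; omega
  rw [innerF, Function.comp_apply, Function.comp_apply, hinit, foldLoop_apply _ _ hk, sndPow_succ_boolPair,
    sndPow_succ_boolPair, sndPow_zero_boolPair, foldAcc_clipF, foldAcc_appF, List.nil_append]
  · unfold colBits
    refine ccat_congr fun i' _ => ?_
    rw [Nat.zero_add]
    exact tripleF_qArg κ j κ' w i i'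
  · intro i' _ _
    rw [show boolPair (boolPair w (ones i)) (ones i') = qArg w i i' from rfl, tripleF_qArg]
    simp only [List.length_cons, List.length_nil]
    omega

/-- **Value of a row** on `a = ⟨w, 1ⁱ⟩`. [folklore] -/
theorem rowF_boolPair (κ : Kind) (j : ℕ) (w : List Bool) (i : ℕ) : rowF κ j (boolPair w (ones i)) = rowBits w κ j i := by
  simp only [rowF, innerF_boolPair, rowBits]

/-- **Value of a group** on `a = ⟨w, 1ⁱ⟩`. [folklore] -/
theorem groupF_boolPair (κ : Kind) (w : List Bool) (i : ℕ) : groupF κ (boolPair w (ones i)) = groupBits w κ i := by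
  simp only [groupF, rowF_boolPair, groupBits]

/-- **Value of a block** (unclipping: a group has `36 r ≤ 36 (|w| + 1)` bits). [folklore] -/
theorem blockF_apply (κ : Kind) (w : List Bool) : blockF κ w = blockBits w κ := by
  have hinit : blockFoldInit w = boolPair w (boolPair (encodeNat (rOf w)) (boolPair (ones 0) [])) := by
    simp [blockFoldInit, fanoutFn_apply, rOf]
  have hk : rOf w ≤ X.eval w.length := by rw [eval_X]; exact rOf_le w
  rw [blockF, Function.comp_apply, Function.comp_apply, hinit, foldLoop_apply _ _ hk, sndPow_succ_boolPair,
    sndPow_succ_boolPair, sndPow_zero_boolPair, foldAcc_clipF, foldAcc_appF, List.nil_append]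
  · unfold blockBits
    refine ccat_congr fun i _ => ?_
    rw [Nat.zero_add, groupF_boolPair]
  · intro i _ _
    rw [groupF_boolPair, length_groupBits, Cblk]
    have := rOf_le w
    nlinarith

/-- **Value of the adjacency bricks on every string**: `adjBlocksF w = adjBits w`. [folklore] -/
theorem adjBlocksF_apply (w : List Bool) : adjBlocksF w = adjBits w := by
  simp only [adjBlocksF, blockF_apply, adjBits]

/-! ### The adjacency bits are the code of Karp's graph of the slot literals read off `w` -/

/-- The slot literals read off `w`, as a family indexed by the slots of `r = |fstF w|` clauses.
[folklore] -/
def litFamily (w : List Bool) : Slot (rOf w) → Literal ℕ := fun p => litOf w p.1 p.2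

/-- **The block numbering of the vertices**: `t = τ (3r) + (3 i + j) ↦ (kind τ, (i, j))` (kind-major,
`Fin 4 × (Fin r × Fin 3)` through `finProdFinEquiv` twice and `kindEquiv`). [folklore] -/
def vertexEquiv (r : ℕ) : Fin (4 * (r * 3)) ≃ Vtx r :=
  finProdFinEquiv.symm.trans (Equiv.prodCongr kindEquiv finProdFinEquiv.symm)

/-- `vertexEquiv` on a block-numbered index. [folklore] -/
theorem vertexEquiv_apply (r : ℕ) (τ : Fin 4) (i : Fin r) (j : Fin 3) :
    vertexEquiv r (finProdFinEquiv (τ, finProdFinEquiv (i, j))) = (kindEquiv τ, (i, j)) := by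
  simp [vertexEquiv]

/-- **Karp's graph of the slot literals read off `w`, on the vertex set `Fin (12 r)`.**
[cite: Karp1972, §4 Main Theorem (proof), SAT≤3 ∝ CHROMATIC NUMBER] -/
def graphOfCode (w : List Bool) : SimpleGraph (Fin (4 * (rOf w * 3))) :=
  (graph (litFamily w)).comap (vertexEquiv (rOf w))

/-- `graphOfCode w` is isomorphic to Karp's graph of `litFamily w`. [folklore] -/
def graphOfCodeIso (w : List Bool) : graphOfCode w ≃g graph (litFamily w) :=
  SimpleGraph.Iso.comap (vertexEquiv (rOf w)) (graph (litFamily w))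

/-- **The adjacency bit is the table of `KarpChromatic.Adj`.** [cite: Karp1972, §4 Main Theorem
(proof), SAT≤3 ∝ CHROMATIC NUMBER] -/
theorem decide_adj_eq_bitVal (w : List Bool) (κ κ' : Kind) (i i' : Fin (rOf w)) (j j' : Fin 3) :
    @decide (Adj (litFamily w) (κ, (i, j)) (κ', (i', j'))) (Classical.propDecidable _) =
      bitVal w κ j κ' j' i i' := by
  rw [Bool.eq_iff_iff, @Bool.decide_iff _ (Classical.propDecidable _)]
  cases κ <;> cases κ' <;>
    simp [Adj, bitVal, litFamily, Prod.ext_iff, Fin.ext_iff, @eq_comm ℕ (i' : ℕ) (i : ℕ)] <;> tauto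

/-- `List.ofFn` over `Fin (m n)` through `finProdFinEquiv⁻¹` is the row-major flattening. [folklore] -/
theorem ofFn_finProd {α : Type} {m n : ℕ} (F : Fin m × Fin n → α) :
    List.ofFn (fun u : Fin (m * n) => F (finProdFinEquiv.symm u)) =
      (List.ofFn fun a : Fin m => List.ofFn fun b : Fin n => F (a, b)).flatten := by
  rw [List.ofFn_mul]
  refine congrArg List.flatten (congrArg List.ofFn (funext fun a => congrArg List.ofFn (funext fun b => ?_)))
  show F (finProdFinEquiv.symm _) = F (a, b)
  congr 1
  rw [Equiv.symm_apply_eq]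
  exact Fin.ext (by simp only [finProdFinEquiv_apply_val]; ring)

/-- `List.ofFn` over the block-numbered vertex set, block by block. [folklore] -/
theorem ofFn_vertices {α : Type} {r : ℕ} (h : Fin (4 * (r * 3)) → α) :
    List.ofFn h = (List.ofFn fun τ : Fin 4 => (List.ofFn fun i : Fin r => List.ofFn fun j : Fin 3 =>
      h (finProdFinEquiv (τ, finProdFinEquiv (i, j)))).flatten).flatten := by
  have h1 : List.ofFn h = List.ofFn (fun u : Fin (4 * (r * 3)) => (h ∘ finProdFinEquiv) (finProdFinEquiv.symm u)) :=
    congrArg List.ofFn (funext fun u => by rw [Function.comp_apply, Equiv.apply_symm_apply])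
  rw [h1, ofFn_finProd]
  refine congrArg List.flatten (congrArg List.ofFn (funext fun τ => ?_))
  show (List.ofFn fun b : Fin (r * 3) => (h ∘ finProdFinEquiv) (τ, b)) = _
  have h2 : (List.ofFn fun b : Fin (r * 3) => (h ∘ finProdFinEquiv) (τ, b)) =
      List.ofFn (fun u : Fin (r * 3) => (h ∘ finProdFinEquiv ∘ Prod.mk τ ∘ finProdFinEquiv) (finProdFinEquiv.symm u)) :=
    congrArg List.ofFn (funext fun b => by simp only [Function.comp_apply, Equiv.apply_symm_apply])
  rw [h2, ofFn_finProd]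
  rfl

/-- A concatenation of pieces is the flattening of a `List.ofFn`. [folklore] -/
theorem ccat_eq_flatten_ofFn (g : ℕ → List Bool) : ∀ n, ccat g n = (List.ofFn fun i : Fin n => g i).flatten
  | 0 => rfl
  | n + 1 => by
    rw [ccat_succ, ccat_eq_flatten_ofFn g n, List.ofFn_succ', List.concat_eq_append, List.flatten_append]
    simp

/-- `List.ofFn` over `Fin 3`. [folklore] -/
theorem ofFn_three {α : Type} (f : Fin 3 → α) : List.ofFn f = [f 0, f 1, f 2] := by simp [List.ofFn_succ]

/-- `List.ofFn` over `Fin 4`. [folklore] -/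
theorem ofFn_four {α : Type} (f : Fin 4 → α) : List.ofFn f = [f 0, f 1, f 2, f 3] := by simp [List.ofFn_succ]

/-- The adjacency table of `graphOfCode w` as a Boolean function of a pair of vertices (classical
decidability, as in `encodingGraphFin`). [folklore] -/
def adjDec (w : List Bool) : Fin (4 * (rOf w * 3)) × Fin (4 * (rOf w * 3)) → Bool :=
  fun p => @decide ((graphOfCode w).Adj p.1 p.2) (Classical.propDecidable _)

/-- **The adjacency bits read off `w` are the code of `graphOfCode w`.** [cite: AroraBarakCC2009,
§0.1 (adjacency matrix)] -/
theorem adjBits_eq_encode (w : List Bool) : adjBits w = (encodingGraphFin _).encode (graphOfCode w) := by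
  -- the bits
  have hbit : ∀ (τ : Fin 4) (i : Fin (rOf w)) (j : Fin 3) (τ' : Fin 4) (i' : Fin (rOf w)) (j' : Fin 3),
      adjDec w (finProdFinEquiv (τ, finProdFinEquiv (i, j)), finProdFinEquiv (τ', finProdFinEquiv (i', j'))) =
      bitVal w (kindEquiv τ) j (kindEquiv τ') j' i i' := by
    intro τ i j τ' i' j'
    rw [adjDec, ← decide_adj_eq_bitVal, @decide_eq_decide _ _ (Classical.propDecidable _) (Classical.propDecidable _)]
    simp only [graphOfCode, SimpleGraph.comap_adj, vertexEquiv_apply, graph_adj]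
  -- the rows
  have hrow : ∀ (τ : Fin 4) (i : Fin (rOf w)) (j : Fin 3),
      (List.ofFn fun b : Fin (4 * (rOf w * 3)) => adjDec w (finProdFinEquiv (τ, finProdFinEquiv (i, j)), b)) =
      rowBits w (kindEquiv τ) j i := by
    intro τ i j
    rw [ofFn_vertices]
    simp only [hbit, ofFn_four, ofFn_three, kindEquiv_zero, kindEquiv_one, kindEquiv_two, kindEquiv_three,
      List.flatten_cons, List.flatten_nil, List.append_nil, rowBits, colBits, ccat_eq_flatten_ofFn, List.append_assoc,
      Fin.val_zero, Fin.val_one, Fin.val_two]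
  rw [ChromaticNP.encodingGraphFin_encode_eq]
  change adjBits w = List.ofFn (fun t : Fin (_ * _) => adjDec w (finProdFinEquiv.symm t))
  rw [ofFn_finProd, ofFn_vertices]
  simp only [List.flatten_flatten, List.flatten_append, List.map_ofFn, Function.comp_def, hrow, ofFn_four, ofFn_three,
    kindEquiv_zero, kindEquiv_one, kindEquiv_two, kindEquiv_three, List.flatten_cons, List.flatten_nil,
    List.append_nil, adjBits, blockBits, groupBits, ccat_eq_flatten_ofFn, List.append_assoc, Fin.val_zero, Fin.val_one,
    Fin.val_two]

/-- **`adjBlocksF w` is the code of `graphOfCode w`, on every string `w`.** [cite: Karp1972, §4 Main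
Theorem (proof), SAT≤3 ∝ CHROMATIC NUMBER] -/
theorem adjBlocksF_eq_encode (w : List Bool) : adjBlocksF w = (encodingGraphFin _).encode (graphOfCode w) := by
  rw [adjBlocksF_apply, adjBits_eq_encode]

/-! ### On a code, the slot literals read off are the slot literals of the CNF -/

/-- Item `i` of the coded list of the images of `l` under `f` is `f l[i]`. [folklore] -/
theorem item_encList_map {α : Type} (f : α → List Bool) (l : List α) {i : ℕ} (hi : i < l.length) :
    fstF (sndF^[i] (encList (l.map f))) = f l[i] := by
  induction i generalizing l with
  | zero =>
    obtain ⟨a, l, rfl⟩ := List.exists_cons_of_length_pos hi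
    rw [Function.iterate_zero_apply, List.map_cons, encList_cons, fstF_boolPair]
    rfl
  | succ i ih =>
    obtain ⟨a, l, rfl⟩ := List.exists_cons_of_length_pos (by omega : 0 < l.length)
    rw [Function.iterate_succ_apply, List.map_cons, encList_cons, sndF_boolPair, ih l (by simpa using hi)]
    rfl

/-- A code announces its number of clauses: `rOf (encode φ) = |φ|`. [folklore] -/
theorem rOf_encode (φ : CNF ℕ) : rOf (encodingCNF.encode φ) = φ.length := by
  rw [rOf, show encodingCNF.encode φ = _ from listBool_encode_eq_encList encodingClause φ, fstF_boolPair,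
    OracleCompose.unaryEncodeNat_eq_replicate, List.length_replicate]

/-- **The raw slot items of a code** are the codes of the literals at the positions `min j (|c| - 1)`
of its clauses `c` (the clause items, their headers and their literal items read through
`item_encList_map`). [folklore] -/
theorem sOf_encode (φ : CNF ℕ) {i : ℕ} (hi : i < φ.length) (hne : φ[i] ≠ []) (j : ℕ) :
    sOf (encodingCNF.encode φ) i j = encodingLiteral.encode (φ[i].get ⟨min j (φ[i].length - 1), by
      have := List.length_pos_of_ne_nil hne; omega⟩) := by
  have ha : aOf (encodingCNF.encode φ) i = encodingClause.encode φ[i] := by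
    rw [aOf, show encodingCNF.encode φ = _ from listBool_encode_eq_encList encodingClause φ, sndF_boolPair,
      item_encList_map _ _ hi]
  have hk : kOf (encodingCNF.encode φ) i = φ[i].length := by
    rw [kOf_eq, ha, KSATRed.length_fstF_encode_clause]
  have hu : ∀ {m : ℕ} (hm : m < φ[i].length), uOf (encodingCNF.encode φ) i m = encodingLiteral.encode φ[i][m] := by
    intro m hm
    rw [uOf, ha, show encodingClause.encode φ[i] = _ from listBool_encode_eq_encList encodingLiteral φ[i],
      sndF_boolPair, item_encList_map _ _ hm]
  rw [sOf, hk, hu, List.get_eq_getElem]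

/-- The slot literals of a nonempty clause are its literals at the positions `min j (|c| - 1)`.
[folklore] -/
theorem slotOfClause_eq_getElem {c : Clause ℕ} (hne : c ≠ []) (j : Fin 3) :
    slotOfClause c j = c.get ⟨min (j : ℕ) (c.length - 1), by have := List.length_pos_of_ne_nil hne; omega⟩ := by
  unfold slotOfClause
  match c, hne, j with
  | [], hne, _ => exact absurd rfl hne
  | [l], _, ⟨0, _⟩ => rfl
  | [l], _, ⟨1, _⟩ => rfl
  | [l], _, ⟨2, _⟩ => rfl
  | [l₁, l₂], _, ⟨0, _⟩ => rfl
  | [l₁, l₂], _, ⟨1, _⟩ => rfl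
  | [l₁, l₂], _, ⟨2, _⟩ => rfl
  | l₁ :: l₂ :: l₃ :: t, _, ⟨0, _⟩ => rfl
  | l₁ :: l₂ :: l₃ :: t, _, ⟨1, _⟩ => rfl
  | l₁ :: l₂ :: l₃ :: t, _, ⟨2, _⟩ => rfl

/-- **On a code without empty clauses, the slot literals read off are the slot literals of the CNF.**
[folklore] -/
theorem litOf_encode (φ : CNF ℕ) {i : ℕ} (hi : i < φ.length) (hne : φ[i] ≠ []) (j : Fin 3) :
    litOf (encodingCNF.encode φ) i j = slotOfClause φ[i] j := by
  rw [litOf, sOf_encode φ hi hne, slotOfClause_eq_getElem hne,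
    show ∀ l : Literal ℕ, encodingLiteral.encode l = boolPair (encodeNat l.1) [l.2] from fun _ => rfl, fstF_boolPair,
    sndF_boolPair, bitsToNat_encodeNat]
  rfl

/-- Colourability of Karp's graph depends only on the slot literals (transport along `r = r'`).
[folklore] -/
theorem colorable_graph_congr {r r' : ℕ} (h : r = r') {L : Slot r → Literal ℕ} {L' : Slot r' → Literal ℕ}
    (hL : ∀ (i : Fin r) (j : Fin 3), L (i, j) = L' (Fin.cast h i, j)) (k : ℕ) :
    (graph L).Colorable k ↔ (graph L').Colorable k := by
  subst h
  have hc : ∀ i : Fin r, Fin.cast rfl i = i := fun i => Fin.ext rfl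
  have : L = L' := funext fun p => by
    obtain ⟨i, j⟩ := p
    rw [hL, hc]
  rw [this]

/-- **On the code of a CNF of width `≤ 3` without empty clauses, `graphOfCode` is colourable with
`3r + 1` colours iff the CNF is satisfiable.** [cite: Karp1972, §4 Main Theorem (proof), SAT≤3 ∝
CHROMATIC NUMBER] -/
theorem colorable_graphOfCode_encode_iff (φ : CNF ℕ) (hw : φ.IsWidthLE 3) (hne : ∀ c ∈ φ, c ≠ []) :
    (graphOfCode (encodingCNF.encode φ)).Colorable (rOf (encodingCNF.encode φ) * 3 + 1) ↔ φ.Satisfiable := by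
  have hr := rOf_encode φ
  rw [SimpleGraph.colorable_congr (graphOfCodeIso _),
    colorable_graph_congr hr (L' := slotLit φ) (fun i j => ?_), hr, ← colorable_iff_satisfiable φ hw
      (fun h => hne [] h rfl)]
  have hi : i.val < φ.length := hr ▸ i.2
  exact litOf_encode φ hi (hne _ (List.getElem_mem hi)) j

/-! ### The guard and the numerals -/

/-- The nonemptiness test is one-bit. [folklore] -/
theorem oneBit_nonemptyFn : OneBit nonemptyFn := (oneBit_allFn oneBit_neItem).comp _

/-- **The nonemptiness test on a code.** [folklore] -/
theorem nonemptyFn_encode (φ : CNF ℕ) : nonemptyFn (encodingCNF.encode φ) = [decide (∀ c ∈ φ, c ≠ [])] := by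
  rw [nonemptyFn, Function.comp_apply, fanoutFn_apply, show encodingCNF.encode φ = _ from
    listBool_encode_eq_encList encodingClause φ, sndF_boolPair, allFn_boolPair oneBit_neItem, decNil_encList]
  congr 1
  rw [decide_eq_decide]
  simp only [List.forall_mem_map, notFn_apply (KSATRed.widthItemFn_boolPair 0 [] _), List.cons.injEq, and_true,
    Bool.not_eq_true', decide_eq_false_iff_not, Nat.le_zero, List.length_eq_zero_iff, ne_eq,
    show ∀ c : Clause ℕ, encodingClause.encode c = _ from listBool_encode_eq_encList encodingLiteral, fstF_boolPair,
    OracleCompose.unaryEncodeNat_eq_replicate, List.replicate_eq_nil_iff]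

/-- **The guard on a code.** [folklore] -/
theorem guard3F_encode (φ : CNF ℕ) :
    guard3F (encodingCNF.encode φ) = [decide (φ.IsWidthLE 3) && decide (∀ c ∈ φ, c ≠ [])] := by
  have hc : KSATRed.isCanonFn (encodingCNF.encode φ) = [true] := by
    rw [KSATRed.isCanonFn_apply, KSATRed.decCNF_encode]; simp
  rw [guard3F, andFn_apply (andFn_apply hc (KSATRed.widthLEFn_encode 3 φ)) (nonemptyFn_encode φ), Bool.true_and]

/-- The guard on a non-code. [folklore] -/
theorem guard3F_of_not_canon {x : List Bool} (hx : encodingCNF.encode (decCNF x) ≠ x) : guard3F x = [false] := by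
  have hc : KSATRed.isCanonFn x = [false] := by rw [KSATRed.isCanonFn_apply]; simp [hx]
  obtain ⟨b, hb⟩ := KSATRed.oneBit_widthLEFn 3 x
  obtain ⟨b', hb'⟩ := oneBit_nonemptyFn x
  rw [guard3F, andFn_apply (andFn_apply hc hb) hb']
  simp

/-- **Value of Karp's map**: `⟨⟨⌜12 r⌝, adjacency bits⟩, ⌜3 r + 1⌝⟩`. [folklore] -/
theorem karpFn_apply (w : List Bool) :
    karpFn w = boolPair (boolPair (encodeNat (4 * (rOf w * 3))) (adjBlocksF w)) (encodeNat (rOf w * 3 + 1)) := by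
  have h3 : threeRF w = encodeNat (rOf w * 3) := by
    simp [threeRF, fanoutFn_apply, rOf]
  simp [karpFn, vertexNumF, colourNumF, fanoutFn_apply, h3]

/-- **Karp's map emits the code of the instance `(graphOfCode w, 3 r + 1)`.** [cite: Karp1972, §4 Main
Theorem (proof), SAT≤3 ∝ CHROMATIC NUMBER] -/
theorem karpFn_eq_encode (w : List Bool) :
    karpFn w = (encodingGraph.pairBool encodingNatBool).encode
      ((⟨4 * (rOf w * 3), graphOfCode w⟩ : Σ n, SimpleGraph (Fin n)), rOf w * 3 + 1) := by
  rw [karpFn_apply, adjBlocksF_eq_encode]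
  rfl

/-- A member of `CHROMATIC` is a pair, of length `≥ 2`; so `[1] ∉ CHROMATIC`. [folklore] -/
theorem singleton_not_mem_CHROMATIC : [true] ∉ CHROMATIC := by
  rintro ⟨⟨⟨m, G⟩, k⟩, -, h⟩
  have := congrArg List.length h
  change (boolPair _ _).length = 1 at this
  rw [length_boolPair] at this
  omega

/-! ### The reduction and the discharge -/

/-- **`3SAT ≤ₚ CHROMATIC NUMBER`** (Karp 1972: SATISFIABILITY WITH AT MOST 3 LITERALS PER CLAUSE ∝
CHROMATIC NUMBER; `3SAT = kSAT 3`, Arora–Barak Thm. 2.10 (2)). [cite: Karp1972, §4 Main Theorem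
(proof), SAT≤3 ∝ CHROMATIC NUMBER] -/
theorem kSAT_three_karpReducible_CHROMATIC : kSAT 3 ≤ₚ CHROMATIC := by
  refine ⟨toChromFn, toChromFn_mem_FP, fun x => ?_⟩
  show x ∈ kSAT 3 ↔ toChromFn x ∈ CHROMATIC
  by_cases hx : encodingCNF.encode (decCNF x) = x
  · generalize decCNF x = φ at hx
    subst hx
    rw [mem_kSAT_iff]
    by_cases hg : φ.IsWidthLE 3 ∧ ∀ c ∈ φ, c ≠ []
    · have hgt : guard3F (encodingCNF.encode φ) = [true] := by
        rw [guard3F_encode, decide_eq_true hg.1, decide_eq_true hg.2, Bool.and_self]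
      rw [toChromFn, iteFn_apply_true hgt, karpFn_eq_encode, CHROMATIC, Encoding.mem_toLanguage_iff]
      change _ ↔ (graphOfCode (encodingCNF.encode φ)).Colorable (rOf (encodingCNF.encode φ) * 3 + 1)
      rw [colorable_graphOfCode_encode_iff φ hg.1 hg.2]
      exact ⟨fun h => h.2, fun h => ⟨hg.1, h⟩⟩
    · have hgf : guard3F (encodingCNF.encode φ) = [false] := by
        rw [guard3F_encode]
        by_cases hW : φ.IsWidthLE 3
        · have hN : ¬ ∀ c ∈ φ, c ≠ [] := fun h => hg ⟨hW, h⟩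
          simp [hW, hN]
        · simp [hW]
      rw [toChromFn, iteFn_apply_false hgf]
      constructor
      · rintro ⟨hw', hsat⟩
        exfalso
        refine hg ⟨hw', fun c hc hnil => ?_⟩
        subst hnil
        exact CNF.not_satisfiable_of_nil_mem hc hsat
      · intro h
        exact absurd h singleton_not_mem_CHROMATIC
  · rw [toChromFn, iteFn_apply_false (guard3F_of_not_canon hx)]
    constructor
    · intro h
      exact absurd (KSATRed.encode_decCNF_of_mem h) hx
    · intro h
      exact absurd h singleton_not_mem_CHROMATIC

end KarpChromatic

/-- **Discharge of `isNPComplete_CHROMATIC`** (`KarpProblems.lean`, pnp.S10; Karp 1972, Main Theorem,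
problem 12): CHROMATIC NUMBER is NP-complete — `3SAT` is NP-complete (`isNPComplete_kSAT_three_holds`,
Arora–Barak Thm. 2.10 (2)), `kSAT 3 ≤ₚ CHROMATIC` (Karp's reduction, `KarpChromatic.kSAT_three_karpReducible_CHROMATIC`),
and `CHROMATIC ∈ NP` (`ChromaticNP.CHROMATIC_mem_NP`), completeness propagating along the reduction
(`IsComplete.of_reducible_holds`). [cite: Karp1972, §4 Main Theorem, problem 12 (CHROMATIC NUMBER)] -/
theorem isNPComplete_CHROMATIC_holds : isNPComplete_CHROMATIC := by
  have h : IsNPComplete (kSAT 3) := isNPComplete_kSAT_three_holds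
  exact IsComplete.of_reducible_holds h KarpChromatic.kSAT_three_karpReducible_CHROMATIC ChromaticNP.CHROMATIC_mem_NP

end Literature.Computability.Complexity

end
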